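import Summits.HubbardSuperconductivity.HubbardSuperconductivity.Theorems.AnisotropyChordSpinBlowUpHamiltonian
import Summits.HubbardSuperconductivity.HubbardSuperconductivity.Theorems.AnisotropyChordEnergyConvexHolds
import Summits.HubbardSuperconductivity.HubbardSuperconductivity.Theorems.AnisotropyChordEnergyConvexAllGraphs
import Literature.MathematicalPhysics.QuantumLattice.SectorGroundProjContinuity
import Literature.MathematicalPhysics.QuantumLattice.SectorEigenvalueContinuation

/-!
# Route `AnisotropyChord`: THEOREM E-CONV(S) — energy convexity along the magnetisation ladder for
# EVERY SPIN, by the copy blow-up (theory seat memo ROTOR-THEORY-6 §72; the `D = h = 0` slice of the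
# typed `XXZSpinDSectorEnergyConvex` of `…EnergyConvexityDefs` is now a tree theorem)

* `sum_mag_blowUpCount`, `blowUpIso_mulVec_mem`, `blowUpIso_conjTranspose_mulVec_mem` — the isometry
  `J` and its adjoint respect the magnetisation sectors;
* `star_blowUpIso_mulVec_self`, `star_blowUpIso_mulVec_xxz` — `J` preserves norms and XXZ energies;
  `xxz_mul_blowUpIso_conjTranspose` — the adjoint intertwining `H_{n/2} Jᴴ = Jᴴ H_{½}`;
* `lowestEnergy_blowUp_le` (variational, every coupling) and `lowestEnergy_le_blowUp` (`Jᴴψ'` for the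
  entrywise non-negative sector ground state `ψ'` of the blow-up — `xxz_exists_nonneg_sectorGroundState`,
  reducible Perron–Frobenius, ANY graph — is a non-zero eigenvector of `H_{n/2}` with the blow-up's
  sector energy) ⇒ **`lowestEnergy_blowUp_eq`: `E^{(n/2)}_G(M) = E^{(½)}_{G'}(M)`** for every
  non-trivial sector, `G' = blowUpGraph n G`;
* **`xxzSpinSectorEnergyConvex`** — for every `n`, every finite graph, `Δ ∈ [−1,1]`:
  `2E(M) ≤ E(M−1) + E(M+1)` for `xxzHamiltonian n G (−1) Δ` (from the spin-½ tree theorem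
  `xxzSectorEnergyConvex_holds` on the blow-up); `xxzSpinDSectorEnergyConvex_zero` — the same in the
  binder shape of `XXZSpinDSectorEnergyConvex` at `D = h = 0`.

Physical reading (memo §72/§77): no magnetisation jumps / non-negative inverse compressibility at `T = 0`
for the spin-`S` easy-plane XXZ ferromagnet on every finite graph, and (Δ = −1, bipartite, sublattice
rotation) for the spin-`S` Heisenberg antiferromagnet.  The easy-plane single-ion extension `D_v ≥ 0`
(E-CONV(S,D)) and the rotor / Bose–Hubbard limits (E-CONV-R/BH) are NOT claimed here.  Theory seat
`hubbard-h0-rotor-theory-1`; Tasaki (2020) §2.1.  No definition is introduced.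
-/

set_option linter.dupNamespace false

noncomputable section

namespace Summit.HubbardSuperconductivity.HubbardSuperconductivity.Theorems.AnisotropyChord

open Matrix Complex Finset
open Literature.MathematicalPhysics.QuantumLattice

variable {V : Type} [Fintype V] [DecidableEq V]

/-! ### Magnetisation sectors under the blow-up -/

omit [DecidableEq V] in
/-- The magnetisation of a blown-up configuration is that of its copy counts:
`Σ_{(x,i)} (½ − τ(x,i)) = Σ_x (n/2 − k_x)`. [folklore] -/
theorem sum_mag_blowUpCount (n : ℕ) (τ : V × Fin n → Fin 2) :
    (∑ p : V × Fin n, ((((1 : ℕ) : ℂ)) / 2 - ((τ p : ℕ) : ℂ))) =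
      ∑ x : V, (((n : ℂ)) / 2 - ((blowUpCount n τ x : ℕ) : ℂ)) := by
  rw [Fintype.sum_prod_type]
  refine Finset.sum_congr rfl fun x _ => ?_
  rw [Finset.sum_sub_distrib, Finset.sum_const, Finset.card_univ, Fintype.card_fin, nsmul_eq_mul,
    blowUpCount_apply_val, Finset.card_filter]
  push_cast
  rw [mul_one_div]
  congr 1
  refine Finset.sum_congr rfl fun i _ => ?_
  rcases Fin.exists_fin_two.mp ⟨τ (x, i), rfl⟩ with h | h <;> simp [h]

/-- `J` maps the spin-`n/2` sector `M` into the spin-½ sector `M` of the blow-up. [folklore] -/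
theorem blowUpIso_mulVec_mem (n : ℕ) {M : ℝ} {χ : (V → Fin (n + 1)) → ℂ}
    (hχ : χ ∈ spinZSector (Λ := V) n M) :
    (blowUpIso n : Matrix (V × Fin n → Fin 2) (V → Fin (n + 1)) ℂ) *ᵥ χ ∈
      spinZSector (Λ := V × Fin n) 1 M := by
  rw [LiebMattis.mem_spinZSector_iff] at hχ ⊢
  intro τ hτ
  rw [sum_mag_blowUpCount]
  refine hχ _ fun h0 => hτ ?_
  rw [blowUpIso_mulVec_apply, h0, mul_zero]

/-- `Jᴴ` maps the spin-½ sector `M` of the blow-up into the spin-`n/2` sector `M`. [folklore] -/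
theorem blowUpIso_conjTranspose_mulVec_mem (n : ℕ) {M : ℝ} {ψ : (V × Fin n → Fin 2) → ℂ}
    (hψ : ψ ∈ spinZSector (Λ := V × Fin n) 1 M) :
    (blowUpIso n : Matrix (V × Fin n → Fin 2) (V → Fin (n + 1)) ℂ)ᴴ *ᵥ ψ ∈
      spinZSector (Λ := V) n M := by
  rw [LiebMattis.mem_spinZSector_iff] at hψ ⊢
  intro k hk
  rw [blowUpIso_conjTranspose_mulVec_apply] at hk
  have hsum : (∑ τ ∈ Finset.univ.filter (fun τ : V × Fin n → Fin 2 => blowUpCount n τ = k), ψ τ) ≠ 0 :=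
    fun h => hk (by rw [h, mul_zero])
  obtain ⟨τ, hτ, hψτ⟩ := Finset.exists_ne_zero_of_sum_ne_zero hsum
  rw [Finset.mem_filter] at hτ
  rw [← hτ.2, ← sum_mag_blowUpCount]
  exact hψ τ hψτ

/-! ### Quadratic forms through the isometry -/

/-- `⟨J χ, w⟩ = ⟨χ, Jᴴ w⟩`. [folklore] -/
theorem star_blowUpIso_mulVec_dotProduct (n : ℕ) (χ : (V → Fin (n + 1)) → ℂ)
    (w : (V × Fin n → Fin 2) → ℂ) :
    star ((blowUpIso n : Matrix (V × Fin n → Fin 2) (V → Fin (n + 1)) ℂ) *ᵥ χ) ⬝ᵥ w =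
      star χ ⬝ᵥ ((blowUpIso n : Matrix (V × Fin n → Fin 2) (V → Fin (n + 1)) ℂ)ᴴ *ᵥ w) := by
  rw [Matrix.star_mulVec, Matrix.dotProduct_mulVec]

/-- `J` preserves norms: `⟨Jχ, Jχ⟩ = ⟨χ, χ⟩`. [folklore] -/
theorem star_blowUpIso_mulVec_self (n : ℕ) (χ : (V → Fin (n + 1)) → ℂ) :
    star ((blowUpIso n : Matrix (V × Fin n → Fin 2) (V → Fin (n + 1)) ℂ) *ᵥ χ) ⬝ᵥ
        ((blowUpIso n : Matrix (V × Fin n → Fin 2) (V → Fin (n + 1)) ℂ) *ᵥ χ) = star χ ⬝ᵥ χ := by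
  rw [star_blowUpIso_mulVec_dotProduct, Matrix.mulVec_mulVec, blowUpIso_conjTranspose_mul_self,
    Matrix.one_mulVec]

/-- **Energies through the isometry:** `⟨Jχ, H_{½}(G') Jχ⟩ = ⟨χ, H_{n/2}(G) χ⟩`. [folklore] -/
theorem star_blowUpIso_mulVec_xxz (n : ℕ) (G : SimpleGraph V) [DecidableRel G.Adj] (Jc Δ : ℝ)
    (χ : (V → Fin (n + 1)) → ℂ) :
    star ((blowUpIso n : Matrix (V × Fin n → Fin 2) (V → Fin (n + 1)) ℂ) *ᵥ χ) ⬝ᵥ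
        ((xxzHamiltonian 1 (blowUpGraph n G) Jc Δ : Matrix (V × Fin n → Fin 2) (V × Fin n → Fin 2) ℂ) *ᵥ
          ((blowUpIso n : Matrix (V × Fin n → Fin 2) (V → Fin (n + 1)) ℂ) *ᵥ χ)) =
      star χ ⬝ᵥ ((xxzHamiltonian n G Jc Δ : Matrix (V → Fin (n + 1)) (V → Fin (n + 1)) ℂ) *ᵥ χ) := by
  rw [star_blowUpIso_mulVec_dotProduct, Matrix.mulVec_mulVec, Matrix.mulVec_mulVec, Matrix.mul_assoc,
    blowUp_xxzHamiltonian_mul_blowUpIso, ← Matrix.mul_assoc, blowUpIso_conjTranspose_mul_self,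
    Matrix.one_mul]

/-- **`Jᴴ` intertwines the other way:** `H_{n/2}(G) Jᴴ = Jᴴ H_{½}(G')` (adjoint of
`blowUp_xxzHamiltonian_mul_blowUpIso`, both Hamiltonians Hermitian). [folklore] -/
theorem xxz_mul_blowUpIso_conjTranspose (n : ℕ) (G : SimpleGraph V) [DecidableRel G.Adj] (Jc Δ : ℝ) :
    ((xxzHamiltonian n G Jc Δ : Matrix (V → Fin (n + 1)) (V → Fin (n + 1)) ℂ) *
        (blowUpIso n : Matrix (V × Fin n → Fin 2) (V → Fin (n + 1)) ℂ)ᴴ :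
        Matrix (V → Fin (n + 1)) (V × Fin n → Fin 2) ℂ) =
      ((blowUpIso n : Matrix (V × Fin n → Fin 2) (V → Fin (n + 1)) ℂ)ᴴ *
        (xxzHamiltonian 1 (blowUpGraph n G) Jc Δ : Matrix (V × Fin n → Fin 2) (V × Fin n → Fin 2) ℂ) :
        Matrix (V → Fin (n + 1)) (V × Fin n → Fin 2) ℂ) := by
  have h := congrArg Matrix.conjTranspose (blowUp_xxzHamiltonian_mul_blowUpIso (V := V) n G Jc Δ)
  rw [Matrix.conjTranspose_mul, Matrix.conjTranspose_mul,
    (xxzHamiltonian_isHermitian 1 (blowUpGraph n G) Jc Δ).eq, (xxzHamiltonian_isHermitian n G Jc Δ).eq] at h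
  exact h.symm

/-! ### The sector energies agree -/

/-- **Lower bound through the isometry:** if the spin-`n/2` sector `M` is non-trivial, the spin-½
sector energy of the blow-up is `≤` the spin-`n/2` sector energy: every unit `ψ ∈ 𝓗_M(n/2)` gives a
unit `Jψ ∈ 𝓗_M(½, G')` of the same energy. [folklore] -/
theorem lowestEnergy_blowUp_le (n : ℕ) (G : SimpleGraph V) [DecidableRel G.Adj] (Jc Δ : ℝ) {M : ℝ}
    (hK : spinZSector (Λ := V) n M ≠ ⊥) :
    lowestEnergyInSector 1 (xxzHamiltonian 1 (blowUpGraph n G) Jc Δ) M ≤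
      lowestEnergyInSector n (xxzHamiltonian n G Jc Δ) M := by
  set H' : Matrix (V × Fin n → Fin 2) (V × Fin n → Fin 2) ℂ := xxzHamiltonian 1 (blowUpGraph n G) Jc Δ
    with hH'
  have hH'h : H'.IsHermitian := xxzHamiltonian_isHermitian 1 (blowUpGraph n G) Jc Δ
  set K' := spinZSector (Λ := V × Fin n) 1 M with hK'
  -- the defining infimum on the spin-`n/2` side
  rw [lowestEnergyInSector, Matrix.minEnergyOn]
  obtain ⟨w, hwK, hw0⟩ := Submodule.exists_mem_ne_zero_of_ne_bot hK
  obtain ⟨c, -, -, hc1⟩ := EigenvalueContinuation.exists_normalize hw0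
  refine le_csInf ⟨_, ⟨(c : ℂ) • w, (spinZSector (Λ := V) n M).smul_mem _ hwK, hc1, rfl⟩⟩ ?_
  rintro E ⟨ψ, hψK, hψ1, rfl⟩
  have hJψ : (blowUpIso n : Matrix (V × Fin n → Fin 2) (V → Fin (n + 1)) ℂ) *ᵥ ψ ∈ K' :=
    blowUpIso_mulVec_mem n hψK
  have hle := minEnergyOn_mul_le_re_rayleigh hH'h K' hJψ
  rw [star_blowUpIso_mulVec_self, hψ1, Complex.one_re, mul_one, hH', star_blowUpIso_mulVec_xxz] at hle
  exact hle

/-- **Upper bound through the non-negative ground state of the blow-up (`J = −1`):** if the spin-`n/2`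
sector `M` is non-trivial, `Jᴴψ'` — for `ψ'` the entrywise non-negative sector ground state of the
blow-up (reducible Perron–Frobenius, any graph) — is a NON-ZERO eigenvector of `H_{n/2}(G)` with the
blow-up's sector energy, so the spin-`n/2` sector energy is `≤` it. [folklore] -/
theorem lowestEnergy_le_blowUp (n : ℕ) (G : SimpleGraph V) [DecidableRel G.Adj] (Δ : ℝ) {M : ℝ}
    (hK : spinZSector (Λ := V) n M ≠ ⊥) :
    lowestEnergyInSector n (xxzHamiltonian n G (-1) Δ) M ≤
      lowestEnergyInSector 1 (xxzHamiltonian 1 (blowUpGraph n G) (-1) Δ) M := by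
  set J : Matrix (V × Fin n → Fin 2) (V → Fin (n + 1)) ℂ := blowUpIso n with hJ
  set H' : Matrix (V × Fin n → Fin 2) (V × Fin n → Fin 2) ℂ := xxzHamiltonian 1 (blowUpGraph n G) (-1) Δ
    with hH'
  set HS : Matrix (V → Fin (n + 1)) (V → Fin (n + 1)) ℂ := xxzHamiltonian n G (-1) Δ with hHS
  have hHSh : HS.IsHermitian := xxzHamiltonian_isHermitian n G (-1) Δ
  set K' := spinZSector (Λ := V × Fin n) 1 M with hK'
  set KS := spinZSector (Λ := V) n M with hKS
  -- the spin-½ sector of the blow-up is non-trivial, hence a weight sector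
  obtain ⟨w, hwK, hw0⟩ := Submodule.exists_mem_ne_zero_of_ne_bot hK
  have hJw0 : J *ᵥ w ≠ 0 := by
    intro h0
    have h1 : star (J *ᵥ w) ⬝ᵥ (J *ᵥ w) = star w ⬝ᵥ w := star_blowUpIso_mulVec_self n w
    rw [h0, dotProduct_zero] at h1
    exact (EigenvalueContinuation.re_star_dotProduct_self_pos hw0).ne' (by rw [← h1, Complex.zero_re])
  have hK'ne : K' ≠ ⊥ := by
    rw [Submodule.ne_bot_iff]
    exact ⟨J *ᵥ w, blowUpIso_mulVec_mem n hwK, hJw0⟩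
  obtain ⟨W, hWatt, hMW⟩ := exists_weight_of_sector_ne_bot hK'ne
  obtain ⟨ψ', hψ'0, hψ'nn, hψ'K, hHψ'⟩ := xxz_exists_nonneg_sectorGroundState (blowUpGraph n G) Δ W hWatt
  rw [← hMW] at hψ'K hHψ'
  set E' : ℝ := lowestEnergyInSector 1 H' M with hE'
  -- `χ = Jᴴ ψ'` is a non-zero `E'`-eigenvector of `HS` in the sector
  set χ : (V → Fin (n + 1)) → ℂ := Jᴴ *ᵥ ψ' with hχ
  have hχK : χ ∈ KS := blowUpIso_conjTranspose_mulVec_mem n hψ'K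
  have hχ0 : χ ≠ 0 := by
    obtain ⟨τ₀, hτ₀⟩ := Function.ne_iff.mp hψ'0
    intro h0
    have h1 : χ (blowUpCount n τ₀) = 0 := by rw [h0]; rfl
    rw [hχ, blowUpIso_conjTranspose_mulVec_apply] at h1
    rcases mul_eq_zero.1 h1 with h2 | h2
    · exact (inv_ne_zero (Real.sqrt_ne_zero'.mpr (blowUpFibreCard_pos n _))) (Complex.ofReal_eq_zero.1 h2)
    · -- a sum of non-negative reals containing the positive term at `τ₀`
      have hre : (∑ τ ∈ Finset.univ.filter (fun τ : V × Fin n → Fin 2 => blowUpCount n τ = blowUpCount n τ₀),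
          ψ' τ).re = 0 := by rw [h2, Complex.zero_re]
      rw [Complex.re_sum] at hre
      have hle : ∀ τ ∈ Finset.univ.filter (fun τ : V × Fin n → Fin 2 => blowUpCount n τ = blowUpCount n τ₀),
          0 ≤ (ψ' τ).re := fun τ _ => (hψ'nn τ).1
      have h3 := (Finset.sum_eq_zero_iff_of_nonneg hle).1 hre τ₀
        (Finset.mem_filter.2 ⟨Finset.mem_univ _, rfl⟩)
      apply hτ₀
      exact Complex.ext (by rw [h3]; rfl) (by rw [(hψ'nn τ₀).2]; rfl)
  have hHχ : HS *ᵥ χ = (E' : ℂ) • χ := by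
    rw [hχ, Matrix.mulVec_mulVec, hHS, hJ, xxz_mul_blowUpIso_conjTranspose, ← Matrix.mulVec_mulVec,
      ← hH', hHψ', Matrix.mulVec_smul]
  -- variational bound at `χ`
  have hle := minEnergyOn_mul_le_re_rayleigh hHSh KS hχK
  rw [hHχ, dotProduct_smul, smul_eq_mul, Complex.re_ofReal_mul] at hle
  have hpos : 0 < (star χ ⬝ᵥ χ).re := EigenvalueContinuation.re_star_dotProduct_self_pos hχ0
  rw [lowestEnergyInSector]
  exact le_of_mul_le_mul_right hle hpos

/-- **THEOREM (copy blow-up of sector energies).**  For every spin `n/2`, every finite graph, every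
`Δ`, and every non-trivial magnetisation sector `M`:
`E^{(n/2)}_G(M) = E^{(½)}_{G'}(M)` with `G' = blowUpGraph n G` — the spin-`n/2` XXZ model on `G` and the
spin-½ XXZ model on the copy blow-up have THE SAME sector energies (theory seat memo ROTOR-THEORY-6
§72: «the blow-up is just another graph»). [folklore] -/
theorem lowestEnergy_blowUp_eq (n : ℕ) (G : SimpleGraph V) [DecidableRel G.Adj] (Δ : ℝ) {M : ℝ}
    (hK : spinZSector (Λ := V) n M ≠ ⊥) :
    lowestEnergyInSector n (xxzHamiltonian n G (-1) Δ) M =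
      lowestEnergyInSector 1 (xxzHamiltonian 1 (blowUpGraph n G) (-1) Δ) M :=
  le_antisymm (lowestEnergy_le_blowUp n G Δ hK) (lowestEnergy_blowUp_le n G (-1) Δ hK)

/-- A non-trivial spin-`n/2` sector blows up to a non-trivial spin-½ sector. [folklore] -/
theorem blowUp_sector_ne_bot (n : ℕ) {M : ℝ} (hK : spinZSector (Λ := V) n M ≠ ⊥) :
    spinZSector (Λ := V × Fin n) 1 M ≠ ⊥ := by
  obtain ⟨w, hwK, hw0⟩ := Submodule.exists_mem_ne_zero_of_ne_bot hK
  have hJw0 : (blowUpIso n : Matrix (V × Fin n → Fin 2) (V → Fin (n + 1)) ℂ) *ᵥ w ≠ 0 := by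
    intro h0
    have h1 := star_blowUpIso_mulVec_self n w
    rw [h0, dotProduct_zero] at h1
    exact (EigenvalueContinuation.re_star_dotProduct_self_pos hw0).ne' (by rw [← h1, Complex.zero_re])
  rw [Submodule.ne_bot_iff]
  exact ⟨_, blowUpIso_mulVec_mem n hwK, hJw0⟩

/-! ### E-CONV for every spin -/

/-- **THEOREM E-CONV(S) — energy convexity along the magnetisation ladder for EVERY SPIN** (theory seat
memo ROTOR-THEORY-6 §72, from E-CONV by the copy blow-up): for every `n`, every finite graph `G`, every
`Δ ∈ [−1, 1]` and every `M` with the three sectors `M−1, M, M+1` non-trivial,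
`2·E^{(n/2)}(M) ≤ E^{(n/2)}(M−1) + E^{(n/2)}(M+1)` for `H = xxzHamiltonian n G (−1) Δ`.
(No magnetisation jumps for the spin-`S` easy-plane XXZ ferromagnet / the spin-`S` Heisenberg
antiferromagnet on bipartite graphs after sublattice rotation, on every finite graph.)  Proof:
`lowestEnergy_blowUp_eq` and the spin-½ theorem `xxzSectorEnergyConvex_holds` on `blowUpGraph n G`. [folklore] -/
theorem xxzSpinSectorEnergyConvex (n : ℕ) (G : SimpleGraph V) [DecidableRel G.Adj] {Δ : ℝ}
    (h1 : -1 ≤ Δ) (h2 : Δ ≤ 1) (M : ℝ)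
    (hK0 : spinZSector (Λ := V) n (M - 1) ≠ ⊥) (hK1 : spinZSector (Λ := V) n M ≠ ⊥)
    (hK2 : spinZSector (Λ := V) n (M + 1) ≠ ⊥) :
    2 * lowestEnergyInSector n (xxzHamiltonian n G (-1) Δ) M ≤
      lowestEnergyInSector n (xxzHamiltonian n G (-1) Δ) (M - 1) +
        lowestEnergyInSector n (xxzHamiltonian n G (-1) Δ) (M + 1) := by
  rw [lowestEnergy_blowUp_eq n G Δ hK0, lowestEnergy_blowUp_eq n G Δ hK1, lowestEnergy_blowUp_eq n G Δ hK2]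
  exact xxzSectorEnergyConvex_holds (V × Fin n) (blowUpGraph n G) Δ h1 h2 M
    (blowUp_sector_ne_bot n hK0) (blowUp_sector_ne_bot n hK1) (blowUp_sector_ne_bot n hK2)

/-- **`XXZSpinDSectorEnergyConvex` at `D = h = 0` (every spin, no single-ion term, no field) HOLDS** —
the `D = 0` slice of the theory seat's typed E-CONV(S,D) (`…EnergyConvexityDefs`), by
`xxzDHamiltonian_zero` and `xxzSpinSectorEnergyConvex`. [folklore] -/
theorem xxzSpinDSectorEnergyConvex_zero (n : ℕ) (V' : Type) [Fintype V'] [DecidableEq V']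
    (G : SimpleGraph V') [DecidableRel G.Adj] (Δ : ℝ) (h1 : -1 ≤ Δ) (h2 : Δ ≤ 1) (M : ℝ)
    (hK0 : spinZSector (Λ := V') n (M - 1) ≠ ⊥) (hK1 : spinZSector (Λ := V') n M ≠ ⊥)
    (hK2 : spinZSector (Λ := V') n (M + 1) ≠ ⊥) :
    2 * lowestEnergyInSector n (xxzDHamiltonian n G Δ (fun _ => 0) (fun _ => 0)) M ≤
      lowestEnergyInSector n (xxzDHamiltonian n G Δ (fun _ => 0) (fun _ => 0)) (M - 1) +
        lowestEnergyInSector n (xxzDHamiltonian n G Δ (fun _ => 0) (fun _ => 0)) (M + 1) := by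
  rw [xxzDHamiltonian_zero]
  exact xxzSpinSectorEnergyConvex n G h1 h2 M hK0 hK1 hK2


end Summit.HubbardSuperconductivity.HubbardSuperconductivity.Theorems.AnisotropyChord
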